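import Mathlib
import HarnessLib
import Literature.ModelTheory.FiniteModelTheory.StructCkEquiv
import Summits.ValiantsHypothesis.ValiantsHypothesis.Theorems.SymmetryDialAffinePebble

/-!
# SymmetryDial — what THREE pebble pairs already see: the dual-incidence profile (lemma δ′)

Route `SymmetryDial` (workshop `decomp-valiant`, lens 1, gen 7), item 23711, bottom piece
P′ = `AffinePebblePairs` (`Theorems/SymmetryDialAffinePebble.lean`): for every `k′` two `0/1`-matrices
on `𝔽₂^d × 𝔽₂^d` with `C^{k′}`-equivalent affine matrix structures and different `0/1`-permanents.
Rungs `k′ ≤ 2` are proved; the census instrument (T6′) searches witness families.  This file proves the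
first NECESSARY CONDITION on witnesses in kernel currency — NODE-g6's paper lemma (δ′):

* `incCount A ξ` = the number of ones `(x, y)` of `A` with `ξ(x + y) = 0` (the pair lies in one coset of
  the hyperplane `ker ξ`; for `ξ = 0` it is the number of ones of `A`).  In Fourier terms
  `2·incCount A ξ − |A| = D̂_A(ξ) = Σ_v D_A(v)(−1)^{ξ·v}`, `D_A(v) = #{x : A(x, x+v) = 1}` the
  DIFFERENCE PROFILE of `A`.
* **`incCount_of_pebbleEquiv_three`**: if `𝔄_d(A) ≡_{C³} 𝔄_d(B)` (three pebble pairs) then there is a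
  bijection `η` of the dual vectors with `incCount A ξ = incCount B (η ξ)` for every `ξ` — Spoiler
  pebbles a dual `ξ`, then a point `x`, then a point `y`; Duplicator's three bijections must carry
  `(ξ, x, y)` to `(ξ′, x′, y′)` with `mat` and `inc` preserved, so row-by-row and then dual-by-dual the
  incidence counts agree.  Corollary `incCount_multiset_eq`: the multisets `{incCount A ξ}_ξ`,
  `{incCount B ξ}_ξ` coincide; corollary `card_ones_eq_of_pebbleEquiv_three`: `|A| = |B|`.
* §4, group matrices `grpMat f (x, y) = f (x + y)`: `incCount (grpMat f) ξ = 2^d · kerCount f ξ`,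
  `kerCount f ξ = #{v : f v = 1, ξ·v = 0}`; hence **`kerCount_of_pebbleEquiv_three`** /
  `not_pebbleEquiv_of_kerCount_ne`: group matrices whose hyperplane-section multisets
  (equivalently: Fourier-coefficient multisets of `f`, `g` as `0/1`-functions) differ are separated by
  `k′` pebble pairs for every `k′ ≥ 3` — the certified census filter for the bent / Maiorana–McFarland
  families.
* Consequently (informal reading for the census, NODE-g6 §3–§4): a P′ witness pair at any `k′ ≥ 3`
  (`affinePebbleEquiv_mono`) must have equal multisets `{D̂(ξ)}_{ξ}` — single-edge CFI twists with fibre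
  translations (LTCFI) move the difference profile `D` and their dual-parity multisets differ (NODE-g6
  lemma (δ) with its instrument rows), so three pebble pairs separate them, while two bent
  (Maiorana–McFarland) group matrices of one dimension (`D̂` flat off `0`) pass this filter as soon as
  the weights of `f`, `g` and of their dual bent functions agree, as the census rows T6′-v2 report
  (for a group matrix `D_{M_f}(v) = 2^d · f(v)`; §4 makes this case exact).

LADDER-Valiant rung 0: nothing here bears on VP ≠ VNP.  References: Hella 1996 (bijective pebble game);
Cai–Fürer–Immerman 1992 §6; Atserias–Dawar 2019 §2.1; NODE-g6 of the workshop lineage (lemma δ′).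
-/

set_option linter.dupNamespace false

namespace Summit.ValiantsHypothesis.ValiantsHypothesis.Theorems.SymmetryDialAffinePebbleThree

open Finset
open Literature.ModelTheory.FiniteModelTheory
open SymmetryDialAffinePebble (V AffRel Laff pair RelHolds affStr AffinePebbleEquiv AffinePebblePairs
  affinePebbleEquiv_mono)

variable {d : ℕ}

/-! ### 1. The dual-incidence profile -/

/-- `incCount A ξ` = number of ones `(x, y)` of `A` with `ξ(x + y) = 0`. -/
def incCount (A : V d × V d → Bool) (ξ : V d) : ℕ :=
  ((univ : Finset (V d × V d)).filter fun xy => A xy = true ∧ pair ξ (xy.1 + xy.2) = 0).card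

/-- Row version: ones of row `x` in the `ξ`-coset of `x`. -/
def rowIncCount (A : V d × V d → Bool) (ξ x : V d) : ℕ :=
  ((univ : Finset (V d)).filter fun y => A (x, y) = true ∧ pair ξ (x + y) = 0).card

/-- `incCount` is the sum of its rows. -/
theorem incCount_eq_sum (A : V d × V d → Bool) (ξ : V d) :
    incCount A ξ = ∑ x : V d, rowIncCount A ξ x := by
  classical
  unfold incCount rowIncCount
  rw [card_filter, Fintype.sum_prod_type]
  refine sum_congr rfl fun x _ => ?_
  rw [card_filter]

/-- At the zero dual vector every pair is incident: `incCount A 0 = |A|`. -/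
theorem incCount_zero (A : V d × V d → Bool) :
    incCount A 0 = ((univ : Finset (V d × V d)).filter fun xy => A xy = true).card := by
  unfold incCount
  congr 1
  refine filter_congr fun xy _ => ?_
  simp [pair]

/-! ### 2. Reading relations off a partial isomorphism of affine matrix structures -/

section PartialIso

variable {k : ℕ} {A B : V d × V d → Bool} {p : PebblePosition k (V d ⊕ V d) (V d ⊕ V d)}

/-- Points go to points. -/
theorem exists_inl_of_partialIso
    (hp : @PebblePosition.IsPartialIso k (V d ⊕ V d) (V d ⊕ V d) Laff (affStr A) (affStr B) p)
    {x : V d} {b : V d ⊕ V d} (hpeb : p.Pebbled (.inl x) b) : ∃ x' : V d, b = .inl x' := by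
  have h := hp.2 AffRel.pt (fun _ => Sum.inl x) (fun _ => b) fun _ => hpeb
  have hl : @FirstOrder.Language.Structure.RelMap Laff (V d ⊕ V d) (affStr A) 1 AffRel.pt
      (fun _ => Sum.inl x) := ⟨x, rfl⟩
  obtain ⟨x', hx'⟩ := h.1 hl
  exact ⟨x', hx'⟩

/-- Dual vectors go to dual vectors. -/
theorem exists_inr_of_partialIso
    (hp : @PebblePosition.IsPartialIso k (V d ⊕ V d) (V d ⊕ V d) Laff (affStr A) (affStr B) p)
    {ξ : V d} {b : V d ⊕ V d} (hpeb : p.Pebbled (.inr ξ) b) : ∃ ξ' : V d, b = .inr ξ' := by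
  have h := hp.2 AffRel.dl (fun _ => Sum.inr ξ) (fun _ => b) fun _ => hpeb
  have hl : @FirstOrder.Language.Structure.RelMap Laff (V d ⊕ V d) (affStr A) 1 AffRel.dl
      (fun _ => Sum.inr ξ) := ⟨ξ, rfl⟩
  obtain ⟨ξ', hξ'⟩ := h.1 hl
  exact ⟨ξ', hξ'⟩

/-- The matrix entry on a pair of pebbled points is preserved. -/
theorem mat_iff_of_partialIso
    (hp : @PebblePosition.IsPartialIso k (V d ⊕ V d) (V d ⊕ V d) Laff (affStr A) (affStr B) p)
    {x y x' y' : V d} (hx : p.Pebbled (.inl x) (.inl x')) (hy : p.Pebbled (.inl y) (.inl y')) :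
    A (x, y) = true ↔ B (x', y') = true := by
  have h := hp.2 AffRel.mat ![Sum.inl x, Sum.inl y] ![Sum.inl x', Sum.inl y'] fun j => by
    fin_cases j
    · exact hx
    · exact hy
  have hl : ∀ (C : V d × V d → Bool) (u v : V d),
      (@FirstOrder.Language.Structure.RelMap Laff (V d ⊕ V d) (affStr C) 2 AffRel.mat
        ![Sum.inl u, Sum.inl v] ↔ C (u, v) = true) := by
    intro C u v
    show (∃ a b : V d, _ ∧ _ ∧ _) ↔ _
    constructor
    · rintro ⟨a, b, ha, hb, hab⟩
      simp only [Matrix.cons_val_zero, Matrix.cons_val_one, Sum.inl.injEq] at ha hb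
      rw [ha, hb]; exact hab
    · intro hab; exact ⟨u, v, rfl, rfl, hab⟩
  rw [← hl A x y, ← hl B x' y']
  exact h

/-- Incidence of a pebbled dual with a pair of pebbled points is preserved. -/
theorem inc_iff_of_partialIso
    (hp : @PebblePosition.IsPartialIso k (V d ⊕ V d) (V d ⊕ V d) Laff (affStr A) (affStr B) p)
    {ξ ξ' x y x' y' : V d} (hξ : p.Pebbled (.inr ξ) (.inr ξ')) (hx : p.Pebbled (.inl x) (.inl x'))
    (hy : p.Pebbled (.inl y) (.inl y')) :
    pair ξ (x + y) = 0 ↔ pair ξ' (x' + y') = 0 := by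
  have h := hp.2 AffRel.inc ![Sum.inr ξ, Sum.inl x, Sum.inl y] ![Sum.inr ξ', Sum.inl x', Sum.inl y']
    fun j => by
      fin_cases j
      · exact hξ
      · exact hx
      · exact hy
  have hl : ∀ (C : V d × V d → Bool) (ζ u v : V d),
      (@FirstOrder.Language.Structure.RelMap Laff (V d ⊕ V d) (affStr C) 3 AffRel.inc
        ![Sum.inr ζ, Sum.inl u, Sum.inl v] ↔ pair ζ (u + v) = 0) := by
    intro C ζ u v
    show (∃ a b c : V d, _ ∧ _ ∧ _ ∧ _) ↔ _
    constructor
    · rintro ⟨a, b, c, ha, hb, hc, habc⟩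
      simp only [Matrix.cons_val_zero, Matrix.cons_val_one, Matrix.cons_val, Sum.inr.injEq,
        Sum.inl.injEq] at ha hb hc
      rw [ha, hb, hc]; exact habc
    · intro habc; exact ⟨ζ, u, v, rfl, rfl, rfl, habc⟩
  rw [← hl A ξ x y, ← hl B ξ' x' y']
  exact h

end PartialIso

/-! ### 3. Three pebble rounds force equal dual-incidence profiles -/

/-- **Lemma (δ′).** Three pebble pairs see the dual-incidence profile: if `𝔄_d(A) ≡_{C³} 𝔄_d(B)` then
a bijection of the dual vectors carries `incCount A` to `incCount B`. -/
theorem incCount_of_pebbleEquiv_three (A B : V d × V d → Bool) (h : AffinePebbleEquiv 3 d A B) :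
    ∃ η : V d ≃ V d, ∀ ξ : V d, incCount A ξ = incCount B (η ξ) := by
  classical
  obtain ⟨S, hS⟩ := h
  -- round 1: pebble pair 0 on a dual vector `(ξ, f₁ ξ)`
  obtain ⟨f₁, hf₁⟩ := S.move S.empty_mem 0
  set p₁ : (V d ⊕ V d) → PebblePosition 3 (V d ⊕ V d) (V d ⊕ V d) :=
    fun a => Function.update PebblePosition.empty 0 (some (a, f₁ a)) with hp₁
  have hpeb₁ : ∀ a, (p₁ a).Pebbled a (f₁ a) := fun a => ⟨0, by simp [hp₁]⟩
  have hη : ∀ ξ : V d, ∃ ξ' : V d, f₁ (.inr ξ) = .inr ξ' := fun ξ =>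
    exists_inr_of_partialIso (hS (hf₁ (.inr ξ))) (hpeb₁ (.inr ξ))
  choose η hη using hη
  have hη_inj : Function.Injective η := fun ξ ζ h =>
    Sum.inr_injective (f₁.injective (by rw [hη ξ, hη ζ, h]))
  have hη_bij : Function.Bijective η := ⟨hη_inj, Finite.surjective_of_injective hη_inj⟩
  refine ⟨Equiv.ofBijective η hη_bij, fun ξ => ?_⟩
  simp only [Equiv.ofBijective_apply]
  -- the position after round 1, and its pebble 0
  have hp₁0 : (p₁ (.inr ξ)) 0 = some (.inr ξ, .inr (η ξ)) := by
    simp [hp₁, hη ξ]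
  -- round 2: pebble pair 1 on a point `(x, f₂ x)`
  obtain ⟨f₂, hf₂⟩ := S.move (hf₁ (.inr ξ)) 1
  set p₂ : (V d ⊕ V d) → PebblePosition 3 (V d ⊕ V d) (V d ⊕ V d) :=
    fun b => Function.update (p₁ (.inr ξ)) 1 (some (b, f₂ b)) with hp₂
  have hp₂0 : ∀ b, (p₂ b) 0 = some (.inr ξ, .inr (η ξ)) := fun b => by
    simp only [hp₂]
    rw [Function.update_of_ne (by decide), hp₁0]
  have hp₂1 : ∀ b, (p₂ b) 1 = some (b, f₂ b) := fun b => by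
    simp [hp₂]
  have hg : ∀ x : V d, ∃ x' : V d, f₂ (.inl x) = .inl x' := fun x =>
    exists_inl_of_partialIso (hS (hf₂ (.inl x))) ⟨1, hp₂1 (.inl x)⟩
  choose g hg using hg
  have hg_inj : Function.Injective g := fun x y hxy =>
    Sum.inl_injective (f₂.injective (by rw [hg x, hg y, hxy]))
  have hg_surj : Function.Surjective g := Finite.surjective_of_injective hg_inj
  -- row by row: round 3 with pebble pair 2 on a point `(y, f₃ y)`
  have hrow : ∀ x : V d, rowIncCount A ξ x = rowIncCount B (η ξ) (g x) := by
    intro x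
    obtain ⟨f₃, hf₃⟩ := S.move (hf₂ (.inl x)) 2
    set p₃ : (V d ⊕ V d) → PebblePosition 3 (V d ⊕ V d) (V d ⊕ V d) :=
      fun c => Function.update (p₂ (.inl x)) 2 (some (c, f₃ c)) with hp₃
    have hpos : ∀ c, p₃ c ∈ S.positions := hf₃
    have hp₃0 : ∀ c, (p₃ c) 0 = some (.inr ξ, .inr (η ξ)) := fun c => by
      simp only [hp₃]
      rw [Function.update_of_ne (by decide), hp₂0]
    have hp₃1 : ∀ c, (p₃ c) 1 = some (.inl x, .inl (g x)) := fun c => by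
      simp only [hp₃]
      rw [Function.update_of_ne (by decide), hp₂1, hg x]
    have hp₃2 : ∀ c, (p₃ c) 2 = some (c, f₃ c) := fun c => by
      simp [hp₃]
    have hg₃ : ∀ y : V d, ∃ y' : V d, f₃ (.inl y) = .inl y' := fun y =>
      exists_inl_of_partialIso (hS (hpos (.inl y))) ⟨2, hp₃2 (.inl y)⟩
    choose g₃ hg₃ using hg₃
    have hg₃_inj : Function.Injective g₃ := fun y z hyz =>
      Sum.inl_injective (f₃.injective (by rw [hg₃ y, hg₃ z, hyz]))
    have hg₃_surj : Function.Surjective g₃ := Finite.surjective_of_injective hg₃_inj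
    have hpebξ : ∀ y : V d, (p₃ (.inl y)).Pebbled (.inr ξ) (.inr (η ξ)) := fun y => ⟨0, hp₃0 _⟩
    have hpebx : ∀ y : V d, (p₃ (.inl y)).Pebbled (.inl x) (.inl (g x)) := fun y => ⟨1, hp₃1 _⟩
    have hpeby : ∀ y : V d, (p₃ (.inl y)).Pebbled (.inl y) (.inl (g₃ y)) := fun y =>
      ⟨2, by rw [hp₃2, hg₃ y]⟩
    have hmat : ∀ y, A (x, y) = true ↔ B (g x, g₃ y) = true := fun y =>
      mat_iff_of_partialIso (hS (hpos (.inl y))) (hpebx y) (hpeby y)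
    have hinc : ∀ y, pair ξ (x + y) = 0 ↔ pair (η ξ) (g x + g₃ y) = 0 := fun y =>
      inc_iff_of_partialIso (hS (hpos (.inl y))) (hpebξ y) (hpebx y) (hpeby y)
    unfold rowIncCount
    exact card_bij (fun y _ => g₃ y)
      (fun y hy => by
        obtain ⟨-, hy1, hy2⟩ := mem_filter.1 hy
        exact mem_filter.2 ⟨mem_univ _, (hmat y).1 hy1, (hinc y).1 hy2⟩)
      (fun y _ z _ hyz => hg₃_inj hyz)
      (fun y' hy' => by
        obtain ⟨y, rfl⟩ := hg₃_surj y'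
        obtain ⟨-, hy1, hy2⟩ := mem_filter.1 hy'
        exact ⟨y, mem_filter.2 ⟨mem_univ _, (hmat y).2 hy1, (hinc y).2 hy2⟩, rfl⟩)
  rw [incCount_eq_sum, incCount_eq_sum, sum_congr rfl fun x _ => hrow x]
  exact sum_bij (fun x _ => g x) (fun _ _ => mem_univ _) (fun x _ y _ hxy => hg_inj hxy)
    (fun y _ => by obtain ⟨x, rfl⟩ := hg_surj y; exact ⟨x, mem_univ _, rfl⟩) (fun _ _ => rfl)

/-- **Corollary: equal dual-incidence multisets.** -/
theorem incCount_multiset_eq (A B : V d × V d → Bool) (h : AffinePebbleEquiv 3 d A B) :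
    (univ : Finset (V d)).val.map (incCount A) = (univ : Finset (V d)).val.map (incCount B) := by
  classical
  obtain ⟨η, hη⟩ := incCount_of_pebbleEquiv_three A B h
  have h1 : (univ : Finset (V d)).val.map (incCount A) =
      (univ : Finset (V d)).val.map (incCount B ∘ η) :=
    Multiset.map_congr rfl fun ξ _ => hη ξ
  rw [h1, ← Multiset.map_map, Multiset.map_univ_val_equiv]

/-- `incCount A ξ ≤ |A|`. -/
theorem incCount_le_card_ones (A : V d × V d → Bool) (ξ : V d) :
    incCount A ξ ≤ ((univ : Finset (V d × V d)).filter fun xy => A xy = true).card := by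
  unfold incCount
  exact card_le_card fun xy hxy => by
    obtain ⟨-, h1, -⟩ := mem_filter.1 hxy
    exact mem_filter.2 ⟨mem_univ _, h1⟩

/-- **Corollary: three pebble pairs see the number of ones**, `|A| = |B|` (the zero dual vector of
either side realises the maximum `|·|` of the common profile). -/
theorem card_ones_eq_of_pebbleEquiv_three (A B : V d × V d → Bool) (h : AffinePebbleEquiv 3 d A B) :
    ((univ : Finset (V d × V d)).filter fun xy => A xy = true).card =
      ((univ : Finset (V d × V d)).filter fun xy => B xy = true).card := by
  classical
  obtain ⟨η, hη⟩ := incCount_of_pebbleEquiv_three A B h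
  refine le_antisymm ?_ ?_
  · rw [← incCount_zero A, hη 0]
    exact incCount_le_card_ones B _
  · rw [← incCount_zero B, ← η.apply_symm_apply 0, ← hη (η.symm 0)]
    exact incCount_le_card_ones A _

/-! ### 4. Group matrices: the profile is the hyperplane-section profile of the support

For the census families (bent / Maiorana–McFarland slots, F1′) the matrices are GROUP MATRICES
`grpMat f (x, y) = f (x + y)` of a Boolean function `f` on `𝔽₂^d`.  Then every row of the `ξ`-profile
is a translate of the same set, `incCount (grpMat f) ξ = 2^d · kerCount f ξ` with
`kerCount f ξ = #{v : f v = 1, ξ·v = 0}` (`= wt f` at `ξ = 0`, `= #(supp f ∩ ξ^⊥)` otherwise; note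
`2·kerCount f ξ − wt f = f̂(ξ)`, the Fourier coefficient of the `0/1`-function `f`).  So three pebble
pairs separate `𝔄(grpMat f)` from `𝔄(grpMat g)` unless the multisets `{kerCount f ξ}_ξ` and
`{kerCount g ξ}_ξ` — equivalently the Fourier-coefficient multisets — coincide: the certified form of
the census filter "equal `D̂`-multisets" for group-matrix families (NODE-g6 (δ′), NODE-g7). -/

/-- The group matrix of a Boolean function on `𝔽₂^d`: entry `(x, y)` is `f (x + y)`. -/
def grpMat (f : V d → Bool) : V d × V d → Bool := fun xy => f (xy.1 + xy.2)

/-- Hyperplane-section count of the support: `#{v : f v = 1 ∧ ξ·v = 0}`. -/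
def kerCount (f : V d → Bool) (ξ : V d) : ℕ :=
  ((univ : Finset (V d)).filter fun v => f v = true ∧ pair ξ v = 0).card

/-- Every row of the `ξ`-profile of a group matrix is a translate of `supp f ∩ {ξ = 0}`. -/
theorem rowIncCount_grpMat (f : V d → Bool) (ξ x : V d) :
    rowIncCount (grpMat f) ξ x = kerCount f ξ := by
  classical
  unfold rowIncCount kerCount grpMat
  exact card_equiv (Equiv.addLeft x) fun y => by simp only [mem_filter, mem_univ, true_and,
    Equiv.coe_addLeft]

/-- `incCount (grpMat f) ξ = 2^d · kerCount f ξ`. -/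
theorem incCount_grpMat (f : V d → Bool) (ξ : V d) :
    incCount (grpMat f) ξ = Fintype.card (V d) * kerCount f ξ := by
  rw [incCount_eq_sum, sum_congr rfl fun x _ => rowIncCount_grpMat f ξ x, sum_const, card_univ,
    smul_eq_mul]

/-- **Corollary (the census filter, certified).** Three pebble pairs separate two group matrices
unless a bijection of the duals matches their hyperplane-section profiles. -/
theorem kerCount_of_pebbleEquiv_three (f g : V d → Bool)
    (h : AffinePebbleEquiv 3 d (grpMat f) (grpMat g)) :
    ∃ η : V d ≃ V d, ∀ ξ : V d, kerCount f ξ = kerCount g (η ξ) := by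
  obtain ⟨η, hη⟩ := incCount_of_pebbleEquiv_three _ _ h
  refine ⟨η, fun ξ => ?_⟩
  have hpos : 0 < Fintype.card (V d) := Fintype.card_pos
  have := hη ξ
  rw [incCount_grpMat, incCount_grpMat] at this
  exact Nat.eq_of_mul_eq_mul_left hpos this

/-- Multiset form of `kerCount_of_pebbleEquiv_three`. -/
theorem kerCount_multiset_eq (f g : V d → Bool) (h : AffinePebbleEquiv 3 d (grpMat f) (grpMat g)) :
    (univ : Finset (V d)).val.map (kerCount f) = (univ : Finset (V d)).val.map (kerCount g) := by
  classical
  obtain ⟨η, hη⟩ := kerCount_of_pebbleEquiv_three f g h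
  have h1 : (univ : Finset (V d)).val.map (kerCount f) =
      (univ : Finset (V d)).val.map (kerCount g ∘ η) :=
    Multiset.map_congr rfl fun ξ _ => hη ξ
  rw [h1, ← Multiset.map_map, Multiset.map_univ_val_equiv]

/-- Contrapositive, the form the census uses: group matrices with different hyperplane-section
multisets are separated by three pebble pairs — hence (`affinePebbleEquiv_mono`) by `k′` pebble pairs
for every `k′ ≥ 3`. -/
theorem not_pebbleEquiv_of_kerCount_ne {k' : ℕ} (hk : 3 ≤ k') (f g : V d → Bool)
    (hne : (univ : Finset (V d)).val.map (kerCount f) ≠ (univ : Finset (V d)).val.map (kerCount g)) :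
    ¬ AffinePebbleEquiv k' d (grpMat f) (grpMat g) :=
  fun h => hne (kerCount_multiset_eq f g (affinePebbleEquiv_mono hk h))

end Summit.ValiantsHypothesis.ValiantsHypothesis.Theorems.SymmetryDialAffinePebbleThree
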